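import Summits.Ventures.Crystal3D.Theorems.StickyWulffConstantTextureLiminfTexShadowBilayerFrameRigidity
import HarnessLib

/-!
# TexShadow — AFFINE bilayer-frame rigidity and the (β) SORT: for non-co-axial `BothFcc` plates, `¬InResidualClass` on a
# bilayer-frame pair leaves exactly lane G's PRICED alternatives (lane T, crux `TextureLiminf`, stmt-Ventures-19483; line
# `TexShadow` v6.17 → v6.18; cf-p1 22:45:22Z (g2) «hgen at (0,0) ⇒ ¬RayAlignedAt/¬RegisteredAt for the bilayer frames ⇒
# payerPool_*_thick ⇒ bilayerWallAt_of_payerBound»)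

HONEST FRAMING. Venture `Summits/Ventures/Crystal3D` (cell `crystal3d-full`), helper `--supports` the crux `TextureLiminf`
(stmt-Ventures-19483) of `route-Ventures-StickyWulffConstant`, registered line `TexShadow`.  Rung credit only; F-C1 not moved.
Pure proofs, standard axioms, no new definitions.  This is the T-side half (g2) of the (β) branch UP TO the point where lane G's
payer-pool export (`payerPool_local_sep(_thick)` / `payerPool_offReach(_thick)`, 19480-p2 g9, G-U) is invoked: those lemmas are
keyed on AFFINE frames `(A₁, t₁, A₂, t₂)` and on `¬RayAlignedAt` / `¬RegisteredAt`, so T must (i) identify each bilayer frame's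
AFFINE lattice with the plate's, and (ii) sort `hgen : ¬InResidualClass (A₁ i) (A₂ j) (u₁ i) (u₂ j)` into G's alternatives once
co-axiality is excluded.

* `affine_fcc_eq_of_linear_eq_of_mem` — two affine fcc lattices with the same linear lattice and a common point coincide;
* **`bilayerFrame_affine_eq`** — for an affine fcc plate `stacking L s σ = (P· + s) '' Λ₀` and `BilayerFramesAt L s σ A u`:
  `(A i · + u i) '' Λ₀ = (P· + s) '' Λ₀` for every `i` (the linear half is `bilayerFrame_image_eq`, …BilayerFrameRigidity);
* `not_affine_coax_of_not_coAx` — if the plates' linear lattices are NOT co-axial, no bilayer-frame pair is affinely co-axial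
  (the first conjunct of `InResidualClass`);
* **`priced_alternatives_of_not_coAx`** — hence `¬InResidualClass (A₁ i) (A₂ j) (u₁ i) (u₂ j)` for a non-co-axial `BothFcc`
  pair means: `¬RayAlignedAt ∨ Σ9OneSided ∨ Σ9OneSidedDown ∨ Σ9Tilt ∨ Σ9TiltDown ∨ Σ9Wide ∨ Σ9WideDown ∨ SeparatedWide ∨
  ¬RegisteredAt` on that frame pair — lane G's priced classes ((β-i) `¬Registered`, (β-ii) `¬RayAligned`: payer-pool export;
  (β-iii) the six `Σ9` cells + `SeparatedWide`: waits for L-2, cf-p1 22:31:11Z).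
WHAT THIS IS NOT: not the invocation of the payer-pool lemmas (their `_thick` forms, g1, are being landed by 19480-p2); F-C1
not moved.
-/

noncomputable section

open scoped InnerProductSpace

namespace Summit.Ventures.Crystal3D.Theorems

open Summit.Ventures.Crystal3D
open Summit.Ventures.Crystal3D.TentCertificate (bilayer_eq_image bilayer_subset_stacking sub_mem_fccRef neg_mem_fccRef)
open Literature.MathematicalPhysics.StatisticalMechanics (fccStacking barlowStacking barlowPos IsHaggSeq)
open Summit.Ventures.Crystal3D.Cruxes.TextureLiminf.TexShadow (E3 e₃ fccRef stacking bilayer SharedAxis CoAx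
  BilayerFramesAt InResidualClass)

/-- Two affine fcc lattices with the same LINEAR lattice and a common point are equal. -/
theorem affine_fcc_eq_of_linear_eq_of_mem {A P : E3 ≃ₗᵢ[ℝ] E3} {u s x₀ : E3} (hlin : A '' fccRef = P '' fccRef)
    (hxA : x₀ ∈ (fun q => A q + u) '' fccRef) (hxP : x₀ ∈ (fun q => P q + s) '' fccRef) :
    (fun q => A q + u) '' fccRef = (fun q => P q + s) '' fccRef := by
  have key : ∀ {A P : E3 ≃ₗᵢ[ℝ] E3} {u s : E3}, A '' fccRef = P '' fccRef →
      x₀ ∈ (fun q => A q + u) '' fccRef → x₀ ∈ (fun q => P q + s) '' fccRef →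
      (fun q => A q + u) '' fccRef ⊆ (fun q => P q + s) '' fccRef := by
    intro A P u s hlin hxA hxP
    obtain ⟨a₀, ha₀, hx₁⟩ := hxA
    obtain ⟨p₀, hp₀, hx₂⟩ := hxP
    rintro _ ⟨a, ha, rfl⟩
    have hd : A (a - a₀) ∈ P '' fccRef := by rw [← hlin]; exact ⟨a - a₀, sub_mem_fccRef ha ha₀, rfl⟩
    obtain ⟨p', hp', hp'e⟩ := hd
    refine ⟨p' - -p₀, sub_mem_fccRef hp' (neg_mem_fccRef hp₀), ?_⟩
    simp only at hx₁ hx₂ ⊢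
    rw [sub_neg_eq_add, map_add, hp'e, map_sub]
    rw [← hx₁] at hx₂
    -- `P p₀ + s = A a₀ + u`
    calc A a - A a₀ + P p₀ + s = A a - A a₀ + (P p₀ + s) := by abel
      _ = A a - A a₀ + (A a₀ + u) := by rw [hx₂]
      _ = A a + u := by abel
  exact Set.Subset.antisymm (key hlin hxA hxP) (key hlin.symm hxP hxA)

/-- **Every bilayer frame of an affine fcc plate carries the plate's AFFINE lattice.** -/
theorem bilayerFrame_affine_eq {σ : ℤ → ℤ} (hσ : IsHaggSeq σ) {L P : E3 ≃ₗᵢ[ℝ] E3} {s : E3}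
    (hS : stacking L s σ = (fun q => P q + s) '' fccStacking 1 (Real.sqrt (2 / 3)))
    {A : ℤ → (E3 ≃ₗᵢ[ℝ] E3)} {u : ℤ → E3} (hfr : BilayerFramesAt L s σ A u) (i : ℤ) :
    (fun q => A i q + u i) '' fccStacking 1 (Real.sqrt (2 / 3)) =
      (fun q => P q + s) '' fccStacking 1 (Real.sqrt (2 / 3)) := by
  have hlin := bilayerFrame_image_eq hσ hS hfr i
  have hx : L (barlowPos 1 (Real.sqrt (2 / 3)) σ i 0 0) + s ∈ bilayer L s σ i := by
    rw [bilayer_eq_image]; exact ⟨_, Or.inl ⟨0, 0, rfl⟩, rfl⟩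
  have hxP : L (barlowPos 1 (Real.sqrt (2 / 3)) σ i 0 0) + s ∈
      (fun q => P q + s) '' fccStacking 1 (Real.sqrt (2 / 3)) := by
    have h := bilayer_subset_stacking L s σ i hx; rw [hS] at h; exact h
  exact affine_fcc_eq_of_linear_eq_of_mem hlin (hfr i hx) hxP

/-- **Non-co-axial plates have no affinely co-axial bilayer-frame pair** (the first conjunct of `InResidualClass` fails). -/
theorem not_affine_coax_of_not_coAx {σ₁ σ₂ : ℤ → ℤ} (hσ₁ : IsHaggSeq σ₁) (hσ₂ : IsHaggSeq σ₂)
    {L₁ L₂ P₁ P₂ : E3 ≃ₗᵢ[ℝ] E3} {s₁ s₂ : E3}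
    (hS₁ : stacking L₁ s₁ σ₁ = (fun q => P₁ q + s₁) '' fccStacking 1 (Real.sqrt (2 / 3)))
    (hS₂ : stacking L₂ s₂ σ₂ = (fun q => P₂ q + s₂) '' fccStacking 1 (Real.sqrt (2 / 3)))
    {A₁ A₂ : ℤ → (E3 ≃ₗᵢ[ℝ] E3)} {u₁ u₂ : ℤ → E3}
    (hfr₁ : BilayerFramesAt L₁ s₁ σ₁ A₁ u₁) (hfr₂ : BilayerFramesAt L₂ s₂ σ₂ A₂ u₂) (hnc : ¬ CoAx P₁ P₂) (i j : ℤ) :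
    ¬ (∃ (L : E3 ≃ₗᵢ[ℝ] E3) (r₁ r₂ : E3) (σ σ' : ℤ → ℤ), IsHaggSeq σ ∧ IsHaggSeq σ' ∧
      (fun p => A₁ i p + u₁ i) '' fccStacking 1 (Real.sqrt (2 / 3)) ⊆
        (fun p => L p + r₁) '' barlowStacking 1 (Real.sqrt (2 / 3)) σ ∧
      (fun p => A₂ j p + u₂ j) '' fccStacking 1 (Real.sqrt (2 / 3)) ⊆
        (fun p => L p + r₂) '' barlowStacking 1 (Real.sqrt (2 / 3)) σ') := by
  rintro ⟨L, r₁, r₂, σ, σ', hσ, hσ', h₁, h₂⟩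
  apply hnc
  rw [← coAx_congr (bilayerFrame_image_eq hσ₁ hS₁ hfr₁ i) (bilayerFrame_image_eq hσ₂ hS₂ hfr₂ j)]
  exact ⟨L e₃, L, r₁ - u₁ i, r₂ - u₂ j, σ, σ', hσ, hσ', rfl,
    (image_fccRef_subset_barlow_iff_affine (A₁ i) L (u₁ i) r₁ σ).1 h₁,
    (image_fccRef_subset_barlow_iff_affine (A₂ j) L (u₂ j) r₂ σ').1 h₂⟩

/-- **The (β) sort.**  For a `BothFcc` pair whose plate lattices are NOT co-axial, `¬InResidualClass` on a bilayer-frame pair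
leaves exactly lane G's priced alternatives on that (affine) frame pair. -/
theorem priced_alternatives_of_not_coAx {σ₁ σ₂ : ℤ → ℤ} (hσ₁ : IsHaggSeq σ₁) (hσ₂ : IsHaggSeq σ₂)
    {L₁ L₂ P₁ P₂ : E3 ≃ₗᵢ[ℝ] E3} {s₁ s₂ : E3}
    (hS₁ : stacking L₁ s₁ σ₁ = (fun q => P₁ q + s₁) '' fccStacking 1 (Real.sqrt (2 / 3)))
    (hS₂ : stacking L₂ s₂ σ₂ = (fun q => P₂ q + s₂) '' fccStacking 1 (Real.sqrt (2 / 3)))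
    {A₁ A₂ : ℤ → (E3 ≃ₗᵢ[ℝ] E3)} {u₁ u₂ : ℤ → E3}
    (hfr₁ : BilayerFramesAt L₁ s₁ σ₁ A₁ u₁) (hfr₂ : BilayerFramesAt L₂ s₂ σ₂ A₂ u₂) (hnc : ¬ CoAx P₁ P₂) {i j : ℤ}
    (hgen : ¬ InResidualClass (A₁ i) (A₂ j) (u₁ i) (u₂ j)) :
    ¬ RayAlignedAt (A₁ i) (A₂ j) ∨ Sigma9OneSidedAt (A₁ i) (A₂ j) ∨ Sigma9OneSidedDownAt (A₁ i) (A₂ j) ∨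
      Sigma9TiltAt (A₁ i) (A₂ j) ∨ Sigma9TiltDownAt (A₁ i) (A₂ j) ∨ Sigma9WideAt (A₁ i) (A₂ j) ∨
      Sigma9WideDownAt (A₁ i) (A₂ j) ∨ SeparatedWideAt (A₁ i) (A₂ j) ∨ ¬ RegisteredAt (A₁ i) (u₁ i) (A₂ j) (u₂ j) := by
  have hnc' := not_affine_coax_of_not_coAx hσ₁ hσ₂ hS₁ hS₂ hfr₁ hfr₂ hnc i j
  by_contra h
  push Not at h
  exact hgen ⟨hnc', h.1, h.2.1, h.2.2.1, h.2.2.2.1, h.2.2.2.2.1, h.2.2.2.2.2.1, h.2.2.2.2.2.2.1, h.2.2.2.2.2.2.2.1,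
    h.2.2.2.2.2.2.2.2⟩

end Summit.Ventures.Crystal3D.Theorems

end
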